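import Mathlib
import Literature.MathematicalPhysics.StatisticalMechanics.Crystallization
import Literature.Analysis.Convex.Subgradient

/-!
# Lennard-Jones in the squared-distance variable: convexity on the good tube and the Bregman remainder
(crux `PhononSlackCertificates.NearFieldConvexity`, stmt-AtomisticToContinuum-13958, stub `stub_certificateOnChartsRef`)

Design step D4 of line `Sketch` writes the site energy through `φ̃(s) = V_LJ(√s) = s⁻⁶/12 − s⁻³/6`
(`s = r²`), whose derivative data are polynomial in `s⁻¹`: `φ̃′(s) = (s⁻⁴ − s⁻⁷)/2`,
`φ̃″(s) = s⁻⁸ (7/2 − 2 s³)`.  Hence `φ̃` is CONVEX exactly for `s³ ≤ 7/4`, i.e. `r ≤ (7/4)^{1/6} ≈ 1.0978`: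
the whole nearest-neighbour range `[0.893, 1.05]` of a `1/20`-good particle lies inside, which is why the
calibrated cluster functional keeps the nearest-neighbour Bregman remainders
`B(s, t) = φ̃(t) − φ̃(s) − φ̃′(s)(t − s) ≥ 0` with their sign (no smallness).  This file proves, on the
explicit interval `(0, 6/5]` (`(6/5)³ = 216/125 ≤ 7/4`; `√(6/5) ≈ 1.095 ≥ 1.05`):
* `lennardJones_sqrt` — `V_LJ(√s) = s⁻⁶/12 − s⁻³/6` for `s > 0`;
* `hasDerivAt_ljSq` — the derivative `(s⁻⁴ − s⁻⁷)/2`;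
* `convexOn_ljSq` — convexity on `(0, 6/5]` (second derivative `≥ 0` there);
* `ljSq_bregman_nonneg` / `stub_ljSqBregman` — the tangent (Bregman) inequality on `(0, 6/5]`.
[folklore]
-/

noncomputable section

open Set
open Literature.MathematicalPhysics.StatisticalMechanics

namespace Summit.AtomisticToContinuum.Crystallization.Theorems.PhononSlackNearFieldConvexity

/-- `V_LJ(√s) = s⁻⁶/12 − s⁻³/6` for `s > 0`. [folklore] -/
theorem lennardJones_sqrt {s : ℝ} (hs : 0 < s) :
    lennardJones (Real.sqrt s) = (1 / 12) * s ^ (-6 : ℤ) - (1 / 6) * s ^ (-3 : ℤ) := by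
  unfold lennardJones
  have h2 : Real.sqrt s ^ 2 = s := Real.sq_sqrt hs.le
  have h12 : (Real.sqrt s)⁻¹ ^ 12 = s ^ (-6 : ℤ) := by
    rw [inv_pow, show (12 : ℕ) = 2 * 6 from rfl, pow_mul, h2, zpow_neg, zpow_ofNat]
  have h6 : (Real.sqrt s)⁻¹ ^ 6 = s ^ (-3 : ℤ) := by
    rw [inv_pow, show (6 : ℕ) = 2 * 3 from rfl, pow_mul, h2, zpow_neg, zpow_ofNat]
  rw [h12, h6]

/-- The derivative of `φ̃(s) = s⁻⁶/12 − s⁻³/6` is `φ̃′(s) = (s⁻⁴ − s⁻⁷)/2` (`s ≠ 0`). [folklore] -/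
theorem hasDerivAt_ljSq {s : ℝ} (hs : s ≠ 0) :
    HasDerivAt (fun s : ℝ => (1 / 12) * s ^ (-6 : ℤ) - (1 / 6) * s ^ (-3 : ℤ))
      ((1 / 2) * s ^ (-4 : ℤ) - (1 / 2) * s ^ (-7 : ℤ)) s := by
  have h1 := ((hasDerivAt_zpow (-6) s (Or.inl hs)).const_mul (1 / 12 : ℝ))
  have h2 := ((hasDerivAt_zpow (-3) s (Or.inl hs)).const_mul (1 / 6 : ℝ))
  refine (h1.sub h2).congr_deriv ?_
  rw [show (-6 : ℤ) - 1 = -7 by norm_num, show (-3 : ℤ) - 1 = -4 by norm_num]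
  push_cast
  ring

/-- The derivative of `φ̃′` is `φ̃″(s) = (7/2) s⁻⁸ − 2 s⁻⁵` (`s ≠ 0`). [folklore] -/
theorem hasDerivAt_ljSq_deriv {s : ℝ} (hs : s ≠ 0) :
    HasDerivAt (fun s : ℝ => (1 / 2) * s ^ (-4 : ℤ) - (1 / 2) * s ^ (-7 : ℤ))
      ((7 / 2) * s ^ (-8 : ℤ) - 2 * s ^ (-5 : ℤ)) s := by
  have h1 := ((hasDerivAt_zpow (-4) s (Or.inl hs)).const_mul (1 / 2 : ℝ))
  have h2 := ((hasDerivAt_zpow (-7) s (Or.inl hs)).const_mul (1 / 2 : ℝ))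
  refine (h1.sub h2).congr_deriv ?_
  rw [show (-4 : ℤ) - 1 = -5 by norm_num, show (-7 : ℤ) - 1 = -8 by norm_num]
  push_cast
  ring

/-- `φ̃″(s) = s⁻⁸ (7/2 − 2 s³) ≥ 0` for `0 < s ≤ 6/5` (indeed for `s³ ≤ 7/4`). [folklore] -/
theorem ljSq_deriv2_nonneg {s : ℝ} (hs : 0 < s) (hs' : s ≤ 6 / 5) :
    0 ≤ (7 / 2) * s ^ (-8 : ℤ) - 2 * s ^ (-5 : ℤ) := by
  have key : (7 / 2) * s ^ (-8 : ℤ) - 2 * s ^ (-5 : ℤ) = (7 / 2 - 2 * s ^ 3) / s ^ 8 := by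
    rw [zpow_neg, zpow_neg, zpow_ofNat, zpow_ofNat]
    field_simp
  rw [key]
  refine div_nonneg ?_ (by positivity)
  have : s ^ 3 ≤ (6 / 5) ^ 3 := by gcongr
  nlinarith

/-- **Convexity of `φ̃` on `(0, 6/5]`.** [folklore] -/
theorem convexOn_ljSq :
    ConvexOn ℝ (Ioc (0 : ℝ) (6 / 5)) (fun s : ℝ => (1 / 12) * s ^ (-6 : ℤ) - (1 / 6) * s ^ (-3 : ℤ)) := by
  have hderiv : ∀ s ∈ Ioc (0 : ℝ) (6 / 5), HasDerivWithinAt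
      (fun s : ℝ => (1 / 12) * s ^ (-6 : ℤ) - (1 / 6) * s ^ (-3 : ℤ))
      ((1 / 2) * s ^ (-4 : ℤ) - (1 / 2) * s ^ (-7 : ℤ)) (Ioc (0 : ℝ) (6 / 5)) s :=
    fun s hs => (hasDerivAt_ljSq hs.1.ne').hasDerivWithinAt
  have hcont : ContinuousOn (fun s : ℝ => (1 / 12) * s ^ (-6 : ℤ) - (1 / 6) * s ^ (-3 : ℤ)) (Ioc (0 : ℝ) (6 / 5)) :=
    fun s hs => (hderiv s hs).continuousWithinAt
  refine convexOn_of_hasDerivWithinAt2_nonneg (convex_Ioc 0 (6 / 5)) hcont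
    (fun s hs => ((hasDerivAt_ljSq (interior_subset hs).1.ne').hasDerivWithinAt))
    (fun s hs => ((hasDerivAt_ljSq_deriv (interior_subset hs).1.ne').hasDerivWithinAt)) ?_
  intro s hs
  have hs' : s ∈ Ioc (0 : ℝ) (6 / 5) := interior_subset hs
  exact ljSq_deriv2_nonneg hs'.1 hs'.2

/-- **The Bregman remainder of `φ̃` is non-negative on `(0, 6/5]`**:
`φ̃(t) ≥ φ̃(s) + φ̃′(s)(t − s)` for `s, t ∈ (0, 6/5]`. [folklore] -/
theorem ljSq_bregman_nonneg {s t : ℝ} (hs : 0 < s) (hs' : s ≤ 6 / 5) (ht : 0 < t) (ht' : t ≤ 6 / 5) :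
    (1 / 12) * s ^ (-6 : ℤ) - (1 / 6) * s ^ (-3 : ℤ) +
        ((1 / 2) * s ^ (-4 : ℤ) - (1 / 2) * s ^ (-7 : ℤ)) * (t - s) ≤
      (1 / 12) * t ^ (-6 : ℤ) - (1 / 6) * t ^ (-3 : ℤ) := by
  have hd := (hasDerivAt_ljSq hs.ne').hasFDerivAt
  have h := Literature.Analysis.Convex.ConvexOn.apply_add_fderiv_le convexOn_ljSq ⟨hs, hs'⟩ hd ⟨ht, ht'⟩
  have e : (ContinuousLinearMap.toSpanSingleton ℝ ((1 / 2) * s ^ (-4 : ℤ) - (1 / 2) * s ^ (-7 : ℤ))) (t - s) =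
      ((1 / 2) * s ^ (-4 : ℤ) - (1 / 2) * s ^ (-7 : ℤ)) * (t - s) := by
    rw [ContinuousLinearMap.toSpanSingleton_apply, smul_eq_mul, mul_comm]
  rw [e] at h
  exact h

/-- **Registered helper `stub_ljSqBregman`**: the Bregman inequality for `V_LJ` in the squared distance,
with `lennardJones` itself on both sides (`s = r²`, `t = r′²` in `(0, 6/5]`). [folklore] -/
theorem stub_ljSqBregman : ∀ s t : ℝ, 0 < s → s ≤ 6 / 5 → 0 < t → t ≤ 6 / 5 → lennardJones (Real.sqrt s) + ((1 / 2) * s ^ (-4 : ℤ) - (1 / 2) * s ^ (-7 : ℤ)) * (t - s) ≤ lennardJones (Real.sqrt t) := by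
  intro s t hs hs' ht ht'
  rw [lennardJones_sqrt hs, lennardJones_sqrt ht]
  exact ljSq_bregman_nonneg hs hs' ht ht'

end Summit.AtomisticToContinuum.Crystallization.Theorems.PhononSlackNearFieldConvexity
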